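import Summits.CriticalPhenomena.PercolationContinuityZ3.Theorems.PercNearOneGluingNoHeavyLowerTailForestRayleighTools
import HarnessLib

/-!
# Weighted forest negative correlation — 2-separations I: forests and partition functions across a separator `⊆ {s,t}`

Notation as in `…ForestRayleighTools`: for activities `w : Sym2 V → ℝ`, a free set `D` and a
pinned set `K`, `Z(D;K) = Σ_{G ⊆ D, ⟨G ∪ K⟩ acyclic} ∏_{g ∈ G} w g`.

Let two edge systems live on vertex sets `S₁`, `S₂` with `S₁ ∩ S₂ ⊆ {s,t}` (a separation of
order `≤ 2`; the *marker* `m = st` is the virtual edge of the 2-sum). This file proves the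
two-state decomposition of spanning forests across the separator:

* `reachable_across_sep`: a path of `⟨X₁ ∪ X₂⟩` between vertices of `S₂` is a path of
  `⟨X₂ ∪ m⟩`, the marker being needed only if `s ~ t` in `⟨X₁⟩`;
* `isAcyclic_union_sep_iff`: `⟨X₁ ∪ X₂⟩` is acyclic iff both sides are and `s`, `t` are not joined
  on both sides; `isAcyclic_union_sep_pin_iff`: with the marker pinned on one side, iff both
  `⟨Xᵢ ∪ m⟩` are acyclic;
* `sum_pinned_union`: Fubini for pinned partition functions over a disjoint union of free sets;
* `forestsW_sep_pin` / `forestsW_sep`: for free/pinned sets `Dᵢ, Kᵢ` on the two sides,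
  `Z(D₁∪D₂; K₁∪K₂∪m) = Z(D₁;K₁∪m)·Z(D₂;K₂∪m)` and
  `Z(D₁∪D₂; K₁∪K₂) = Z(D₁;K₁∪m)·Z(D₂;K₂) + Z(D₁;K₁)·Z(D₂;K₂∪m) − Z(D₁;K₁∪m)·Z(D₂;K₂∪m)`.

These feed the 2-sum theorem for the Rayleigh inequality (`…ForestRayleighTwoSum`; Semple–Welsh,
CPC 17 (2008), §5 Question 2, answered for matroids by Cocks and by Wagner 2008). Theorems only;
no definitions, no `sorry`.
-/

open Finset SimpleGraph
open scoped Classical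

namespace Summit.CriticalPhenomena.PercolationContinuityZ3.Theorems.ForestRayleigh

variable {V : Type*} [Fintype V] [DecidableEq V]

/-! ### §1 Reachability across a separator of order ≤ 2 -/

omit [Fintype V] [DecidableEq V] in
/-- If every edge of `A` joins two vertices connected in `⟨B⟩`, reachability in `⟨A⟩` implies
reachability in `⟨B⟩`. [folklore] -/
theorem reachable_of_edges_realized {A B : Finset (Sym2 V)}
    (h : ∀ u v, s(u, v) ∈ A → u ≠ v →
      (fromEdgeSet ((B : Finset (Sym2 V)) : Set (Sym2 V))).Reachable u v)
    {x y : V} (hxy : (fromEdgeSet ((A : Finset (Sym2 V)) : Set (Sym2 V))).Reachable x y) :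
    (fromEdgeSet ((B : Finset (Sym2 V)) : Set (Sym2 V))).Reachable x y := by
  rw [SimpleGraph.reachable_iff_reflTransGen] at hxy
  induction hxy with
  | refl => exact Reachable.refl _
  | tail _ hbc ih =>
    rw [fromEdgeSet_adj, Finset.mem_coe] at hbc
    exact ih.trans (h _ _ hbc.1 hbc.2)

omit [Fintype V] [DecidableEq V] in
/-- Reachability is monotone in the edge system. [folklore] -/
theorem reachable_mono_edges {A B : Finset (Sym2 V)} (hAB : A ⊆ B) {x y : V}
    (hxy : (fromEdgeSet ((A : Finset (Sym2 V)) : Set (Sym2 V))).Reachable x y) :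
    (fromEdgeSet ((B : Finset (Sym2 V)) : Set (Sym2 V))).Reachable x y :=
  hxy.mono (fromEdgeSet_mono (Finset.coe_subset.2 hAB))

omit [Fintype V] in
/-- **Paths across a separator of order ≤ 2.** Let the edges of `X₁` live on `S₁`, those of `X₂`
on `S₂`, `S₁ ∩ S₂ ⊆ {s,t}`, and let `Y ⊇ X₂` join `s` and `t` whenever `⟨X₁⟩` does. If `p` is
joined in `⟨X₁ ∪ X₂⟩` to a vertex `y` of `S₂` then: if `p ∈ S₂` it is joined to `y` in `⟨Y⟩`; if
`p ∈ S₁` it is joined in `⟨X₁⟩` to some `q ∈ {s,t}` that is joined to `y` in `⟨Y⟩`.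
[folklore; the maximal `X₁`-segments of a path run between `s` and `t`] -/
theorem reachable_across_sep {X₁ X₂ Y : Finset (Sym2 V)} {S₁ S₂ : Set V} {s t : V}
    (hX₁ : ∀ z ∈ X₁, ∀ x ∈ z, x ∈ S₁) (hX₂ : ∀ z ∈ X₂, ∀ x ∈ z, x ∈ S₂)
    (hS : ∀ x, x ∈ S₁ → x ∈ S₂ → x = s ∨ x = t) (hY : X₂ ⊆ Y)
    (hm : (fromEdgeSet ((X₁ : Finset (Sym2 V)) : Set (Sym2 V))).Reachable s t →
      (fromEdgeSet ((Y : Finset (Sym2 V)) : Set (Sym2 V))).Reachable s t)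
    {p y : V} (hy : y ∈ S₂)
    (hp : (fromEdgeSet ((X₁ ∪ X₂ : Finset (Sym2 V)) : Set (Sym2 V))).Reachable p y) :
    (p ∈ S₂ → (fromEdgeSet ((Y : Finset (Sym2 V)) : Set (Sym2 V))).Reachable p y) ∧
    (p ∈ S₁ → ∃ q, (q = s ∨ q = t) ∧
      (fromEdgeSet ((X₁ : Finset (Sym2 V)) : Set (Sym2 V))).Reachable p q ∧
      (fromEdgeSet ((Y : Finset (Sym2 V)) : Set (Sym2 V))).Reachable q y) := by
  rw [SimpleGraph.reachable_iff_reflTransGen] at hp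
  induction hp using Relation.ReflTransGen.head_induction_on with
  | refl =>
    refine ⟨fun _ => Reachable.refl _, fun hy₁ => ⟨y, ?_, Reachable.refl _, Reachable.refl _⟩⟩
    exact hS y hy₁ hy
  | head hab hcy ih =>
    rename_i a c
    clear hcy
    rw [fromEdgeSet_adj, Finset.mem_coe, Finset.mem_union] at hab
    obtain ⟨hac | hac, hne⟩ := hab
    · -- an `X₁`-edge `a c`
      have ha₁ : a ∈ S₁ := hX₁ _ hac a (Sym2.mem_mk_left a c)
      have hc₁ : c ∈ S₁ := hX₁ _ hac c (Sym2.mem_mk_right a c)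
      have hadj : (fromEdgeSet ((X₁ : Finset (Sym2 V)) : Set (Sym2 V))).Adj a c :=
        (fromEdgeSet_adj _).2 ⟨Finset.mem_coe.2 hac, hne⟩
      obtain ⟨q, hq, hcq, hqy⟩ := ih.2 hc₁
      have haq : (fromEdgeSet ((X₁ : Finset (Sym2 V)) : Set (Sym2 V))).Reachable a q :=
        hadj.reachable.trans hcq
      refine ⟨fun ha₂ => ?_, fun _ => ⟨q, hq, haq, hqy⟩⟩
      -- `a ∈ S₁ ∩ S₂ ⊆ {s,t}` and `q ∈ {s,t}`
      by_cases hqa : q = a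
      · rw [← hqa]; exact hqy
      have haqY : (fromEdgeSet ((Y : Finset (Sym2 V)) : Set (Sym2 V))).Reachable a q := by
        rcases hS a ha₁ ha₂ with rfl | rfl
        · rcases hq with rfl | rfl
          · exact absurd rfl hqa
          · exact hm haq
        · rcases hq with rfl | rfl
          · exact (hm haq.symm).symm
          · exact absurd rfl hqa
      exact haqY.trans hqy
    · -- an `X₂`-edge `a c`
      have ha₂ : a ∈ S₂ := hX₂ _ hac a (Sym2.mem_mk_left a c)
      have hc₂ : c ∈ S₂ := hX₂ _ hac c (Sym2.mem_mk_right a c)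
      have hadj : (fromEdgeSet ((Y : Finset (Sym2 V)) : Set (Sym2 V))).Adj a c :=
        (fromEdgeSet_adj _).2 ⟨Finset.mem_coe.2 (hY hac), hne⟩
      have hay : (fromEdgeSet ((Y : Finset (Sym2 V)) : Set (Sym2 V))).Reachable a y :=
        hadj.reachable.trans (ih.1 hc₂)
      exact ⟨fun _ => hay, fun ha₁ => ⟨a, hS a ha₁ ha₂, Reachable.refl _, hay⟩⟩

omit [Fintype V] in
/-- **Reachability across a separator, two-sided form.** For `x, y ∈ S₂`:
`x ~ y` in `⟨X₁ ∪ X₂⟩` iff `x ~ y` in `⟨X₂ ∪ m⟩` when `s ~ t` in `⟨X₁⟩` (`m = st`, `s ≠ t`).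
[folklore] -/
theorem reachable_union_sep_iff_of_reachable {X₁ X₂ : Finset (Sym2 V)} {S₁ S₂ : Set V} {s t : V}
    (hX₁ : ∀ z ∈ X₁, ∀ x ∈ z, x ∈ S₁) (hX₂ : ∀ z ∈ X₂, ∀ x ∈ z, x ∈ S₂)
    (hS : ∀ x, x ∈ S₁ → x ∈ S₂ → x = s ∨ x = t) (hst : s ≠ t)
    (hR : (fromEdgeSet ((X₁ : Finset (Sym2 V)) : Set (Sym2 V))).Reachable s t)
    {x y : V} (hx : x ∈ S₂) (hy : y ∈ S₂) :
    (fromEdgeSet ((X₁ ∪ X₂ : Finset (Sym2 V)) : Set (Sym2 V))).Reachable x y ↔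
      (fromEdgeSet ((insert s(s, t) X₂ : Finset (Sym2 V)) : Set (Sym2 V))).Reachable x y := by
  constructor
  · intro h
    refine (reachable_across_sep hX₁ hX₂ hS (Finset.subset_insert _ _) (fun _ => ?_) hy h).1 hx
    exact Adj.reachable ((fromEdgeSet_adj _).2 ⟨Finset.mem_coe.2 (Finset.mem_insert_self _ _), hst⟩)
  · intro h
    refine reachable_of_edges_realized (fun u v huv hne => ?_) h
    rcases Finset.mem_insert.1 huv with huv | huv
    · have hR' := reachable_mono_edges (Finset.subset_union_left (s₂ := X₂)) hR
      rcases Sym2.eq_iff.1 huv with ⟨rfl, rfl⟩ | ⟨rfl, rfl⟩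
      · exact hR'
      · exact hR'.symm
    · exact Adj.reachable ((fromEdgeSet_adj _).2
        ⟨Finset.mem_coe.2 (Finset.mem_union_right _ huv), hne⟩)

omit [Fintype V] in
/-- **Reachability across a separator, two-sided form.** For `x, y ∈ S₂`:
`x ~ y` in `⟨X₁ ∪ X₂⟩` iff `x ~ y` in `⟨X₂⟩` when `s ≁ t` in `⟨X₁⟩`. [folklore] -/
theorem reachable_union_sep_iff_of_not_reachable {X₁ X₂ : Finset (Sym2 V)} {S₁ S₂ : Set V}
    {s t : V} (hX₁ : ∀ z ∈ X₁, ∀ x ∈ z, x ∈ S₁) (hX₂ : ∀ z ∈ X₂, ∀ x ∈ z, x ∈ S₂)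
    (hS : ∀ x, x ∈ S₁ → x ∈ S₂ → x = s ∨ x = t)
    (hR : ¬(fromEdgeSet ((X₁ : Finset (Sym2 V)) : Set (Sym2 V))).Reachable s t)
    {x y : V} (hx : x ∈ S₂) (hy : y ∈ S₂) :
    (fromEdgeSet ((X₁ ∪ X₂ : Finset (Sym2 V)) : Set (Sym2 V))).Reachable x y ↔
      (fromEdgeSet ((X₂ : Finset (Sym2 V)) : Set (Sym2 V))).Reachable x y :=
  ⟨fun h => (reachable_across_sep hX₁ hX₂ hS (subset_refl X₂) (fun h' => absurd h' hR) hy h).1 hx,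
    fun h => reachable_mono_edges Finset.subset_union_right h⟩

/-! ### §2 Forests across a separator of order ≤ 2 -/

/-- **Forests across a separator of order ≤ 2.** With the edges of `X₁` on `S₁`, of `X₂` on
`S₂`, `S₁ ∩ S₂ ⊆ {s,t}`, both loop-free and the marker `st ∉ X₂`: `⟨X₁ ∪ X₂⟩` is acyclic iff
`⟨X₁⟩` and `⟨X₂⟩` are acyclic and `s`, `t` are not joined on both sides. [folklore; a cycle
crossing a 2-separator splits into an `s–t` path on each side] -/
theorem isAcyclic_union_sep_iff {X₁ X₂ : Finset (Sym2 V)} {S₁ S₂ : Set V} {s t : V}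
    (hX₁ : ∀ z ∈ X₁, ∀ x ∈ z, x ∈ S₁) (hX₂ : ∀ z ∈ X₂, ∀ x ∈ z, x ∈ S₂)
    (hS : ∀ x, x ∈ S₁ → x ∈ S₂ → x = s ∨ x = t) (hst : s ≠ t)
    (hL₁ : ∀ z ∈ X₁, ¬z.IsDiag) (hL₂ : ∀ z ∈ X₂, ¬z.IsDiag) (hm : s(s, t) ∉ X₂) :
    (fromEdgeSet ((X₁ ∪ X₂ : Finset (Sym2 V)) : Set (Sym2 V))).IsAcyclic ↔
      (fromEdgeSet ((X₁ : Finset (Sym2 V)) : Set (Sym2 V))).IsAcyclic ∧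
      (fromEdgeSet ((X₂ : Finset (Sym2 V)) : Set (Sym2 V))).IsAcyclic ∧
      ¬((fromEdgeSet ((X₁ : Finset (Sym2 V)) : Set (Sym2 V))).Reachable s t ∧
        (fromEdgeSet ((X₂ : Finset (Sym2 V)) : Set (Sym2 V))).Reachable s t) := by
  induction X₂ using Finset.induction_on with
  | empty =>
    simp only [Finset.union_empty, Finset.coe_empty, fromEdgeSet_empty, isAcyclic_bot,
      reachable_bot, true_and]
    exact ⟨fun h => ⟨h, fun h' => hst h'.2⟩, fun h => h.1⟩
  | insert g X₂ hg ih =>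
    have hX₂' : ∀ z ∈ X₂, ∀ x ∈ z, x ∈ S₂ := fun z hz => hX₂ z (Finset.mem_insert_of_mem hz)
    have hL₂' : ∀ z ∈ X₂, ¬z.IsDiag := fun z hz => hL₂ z (Finset.mem_insert_of_mem hz)
    have hm' : s(s, t) ∉ X₂ := fun h => hm (Finset.mem_insert_of_mem h)
    have hmg : s(s, t) ≠ g := fun h => hm (h ▸ Finset.mem_insert_self g X₂)
    specialize ih hX₂' hL₂' hm'
    revert hg hX₂ hL₂ hm hmg
    refine Sym2.ind (fun x y => ?_) g
    intro hg hX₂ hL₂ hm hmg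
    have hxy : x ≠ y := fun h => hL₂ _ (Finset.mem_insert_self _ _) (Sym2.mk_isDiag_iff.2 h)
    have hx : x ∈ S₂ := hX₂ _ (Finset.mem_insert_self _ _) x (Sym2.mem_mk_left x y)
    have hy : y ∈ S₂ := hX₂ _ (Finset.mem_insert_self _ _) y (Sym2.mem_mk_right x y)
    -- the new edge is not an `X₁`-edge (it would be the marker)
    have hg₁ : s(x, y) ∉ X₁ := by
      intro h
      have hx₁ := hX₁ _ h x (Sym2.mem_mk_left x y)
      have hy₁ := hX₁ _ h y (Sym2.mem_mk_right x y)
      apply hmg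
      rcases hS x hx₁ hx with rfl | rfl <;> rcases hS y hy₁ hy with h' | h'
      · exact absurd h'.symm hxy
      · rw [h']
      · rw [h', Sym2.eq_swap]
      · exact absurd h'.symm hxy
    have hgU : s(x, y) ∉ X₁ ∪ X₂ := by
      rw [Finset.mem_union, not_or]; exact ⟨hg₁, hg⟩
    have hLU : ∀ z ∈ X₁ ∪ X₂, ¬z.IsDiag := by
      intro z hz
      rcases Finset.mem_union.1 hz with hz | hz
      · exact hL₁ z hz
      · exact hL₂' z hz
    rw [Finset.union_insert, ForestExchange.isAcyclic_insert_iff hLU hxy hgU, ih,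
      ForestExchange.isAcyclic_insert_iff hL₂' hxy hg]
    by_cases hR₁ : (fromEdgeSet ((X₁ : Finset (Sym2 V)) : Set (Sym2 V))).Reachable s t
    · rw [reachable_union_sep_iff_of_reachable hX₁ hX₂' hS hst hR₁ hx hy]
      -- exchange of the two inserted edges `xy` and the marker `st`
      have hLm : ∀ z ∈ insert s(s, t) X₂, ¬z.IsDiag := by
        intro z hz
        rcases Finset.mem_insert.1 hz with rfl | hz
        · exact fun h => hst (Sym2.mk_isDiag_iff.1 h)
        · exact hL₂' z hz
      have hgm : s(x, y) ∉ insert s(s, t) X₂ := by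
        rw [Finset.mem_insert, not_or]; exact ⟨hmg.symm, hg⟩
      have hmg' : s(s, t) ∉ insert s(x, y) X₂ := by
        rw [Finset.mem_insert, not_or]; exact ⟨hmg, hm'⟩
      have ex₁ := ForestExchange.isAcyclic_insert_iff hLm hxy hgm
      rw [ForestExchange.isAcyclic_insert_iff hL₂' hst hm', Finset.insert_comm,
        ForestExchange.isAcyclic_insert_iff hL₂ hst hmg',
        ForestExchange.isAcyclic_insert_iff hL₂' hxy hg] at ex₁
      constructor
      · rintro ⟨⟨h₁, h₂, h₃⟩, h₄⟩
        have h₅ : ¬(fromEdgeSet ((X₂ : Finset (Sym2 V)) : Set (Sym2 V))).Reachable s t :=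
          fun h => h₃ ⟨hR₁, h⟩
        have := ex₁.2 ⟨⟨h₂, h₅⟩, h₄⟩
        exact ⟨h₁, this.1, fun h => this.2 h.2⟩
      · rintro ⟨h₁, ⟨h₂, h₃⟩, h₄⟩
        have h₅ : ¬(fromEdgeSet ((insert s(x, y) X₂ : Finset (Sym2 V)) : Set (Sym2 V))).Reachable
            s t := fun h => h₄ ⟨hR₁, h⟩
        have := ex₁.1 ⟨⟨h₂, h₃⟩, h₅⟩
        exact ⟨⟨h₁, h₂, fun h => this.1.2 h.2⟩, this.2⟩
    · rw [reachable_union_sep_iff_of_not_reachable hX₁ hX₂' hS hR₁ hx hy]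
      constructor
      · rintro ⟨⟨h₁, h₂, _⟩, h₄⟩
        exact ⟨h₁, ⟨h₂, h₄⟩, fun h => hR₁ h.1⟩
      · rintro ⟨h₁, ⟨h₂, h₃⟩, _⟩
        exact ⟨⟨h₁, h₂, fun h => hR₁ h.1⟩, h₃⟩

/-- **Forests across a separator, marker pinned.** If moreover `s, t ∈ S₁` then
`⟨(X₁ ∪ st) ∪ X₂⟩` is acyclic iff `⟨X₁ ∪ st⟩` and `⟨X₂ ∪ st⟩` are. [folklore] -/
theorem isAcyclic_union_sep_pin_iff {X₁ X₂ : Finset (Sym2 V)} {S₁ S₂ : Set V} {s t : V}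
    (hX₁ : ∀ z ∈ X₁, ∀ x ∈ z, x ∈ S₁) (hX₂ : ∀ z ∈ X₂, ∀ x ∈ z, x ∈ S₂)
    (hS : ∀ x, x ∈ S₁ → x ∈ S₂ → x = s ∨ x = t) (hst : s ≠ t) (hs₁ : s ∈ S₁) (ht₁ : t ∈ S₁)
    (hL₁ : ∀ z ∈ X₁, ¬z.IsDiag) (hL₂ : ∀ z ∈ X₂, ¬z.IsDiag) (hm₁ : s(s, t) ∉ X₁)
    (hm₂ : s(s, t) ∉ X₂) :
    (fromEdgeSet ((insert s(s, t) X₁ ∪ X₂ : Finset (Sym2 V)) : Set (Sym2 V))).IsAcyclic ↔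
      (fromEdgeSet ((insert s(s, t) X₁ : Finset (Sym2 V)) : Set (Sym2 V))).IsAcyclic ∧
      (fromEdgeSet ((insert s(s, t) X₂ : Finset (Sym2 V)) : Set (Sym2 V))).IsAcyclic := by
  have hX₁' : ∀ z ∈ insert s(s, t) X₁, ∀ x ∈ z, x ∈ S₁ := by
    intro z hz x hxz
    rcases Finset.mem_insert.1 hz with rfl | hz
    · rcases Sym2.mem_iff.1 hxz with rfl | rfl
      · exact hs₁
      · exact ht₁
    · exact hX₁ z hz x hxz
  have hL₁' : ∀ z ∈ insert s(s, t) X₁, ¬z.IsDiag := by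
    intro z hz
    rcases Finset.mem_insert.1 hz with rfl | hz
    · exact fun h => hst (Sym2.mk_isDiag_iff.1 h)
    · exact hL₁ z hz
  have hRm : (fromEdgeSet ((insert s(s, t) X₁ : Finset (Sym2 V)) : Set (Sym2 V))).Reachable s t :=
    Adj.reachable ((fromEdgeSet_adj _).2 ⟨Finset.mem_coe.2 (Finset.mem_insert_self _ _), hst⟩)
  rw [isAcyclic_union_sep_iff hX₁' hX₂ hS hst hL₁' hL₂ hm₂,
    ForestExchange.isAcyclic_insert_iff hL₂ hst hm₂]
  constructor
  · rintro ⟨h₁, h₂, h₃⟩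
    exact ⟨h₁, h₂, fun h => h₃ ⟨hRm, h⟩⟩
  · rintro ⟨h₁, h₂, h₃⟩
    exact ⟨h₁, h₂, fun h => h₃ h.2⟩

end Summit.CriticalPhenomena.PercolationContinuityZ3.Theorems.ForestRayleigh
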